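import Summits.KontsevichZagierPeriods.KontsevichZagierPeriods.Theorems.UnfoldedStokesStokesGenerationFibrewiseRungPermutation

/-!
# `StokesGeneration` (stmt-KontsevichZagierPeriods-3586), line `fibrewise_stokes` — rung 14: subdividing the cube along a
# coordinate hyperplane is absorbed by S2's economy

Crux `Summit.KontsevichZagierPeriods.KontsevichZagierPeriods.Theses.UnfoldedStokes.StokesGeneration`; residual stub S2
`stub_fibrewiseStokesGeneration` (`FibStokesDecomposable`). Cutting `[0,1]^N` at `x_a = t₀` (algebraic `t₀ ∈ (0,1)`) and
rescaling the two boxes back to the cube — Kontsevich–Zagier's additivity rule (1) followed by rule (2) for the two affine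
maps, the only form rule (1) takes inside a cubical calculus — gives the relator
`f(x) − t₀f(x[a ↦ t₀x_a]) − (1 − t₀)f(x[a ↦ t₀ + (1 − t₀)x_a])`. For `f` `ℚ`-semialgebraic, continuous and `C¹` along `a`
it is fibrewise-Stokes decomposable (`fibStokesDecomposable_sub_subdivision`; core form with an idle coordinate
`fibStokesDecomposable_subdivisionCore`): homotopy of the cutting height `τ` from `t₀` to the trivial cut `1` in an idle
coordinate, and the Euler identity `∂_τ r_τ = ∂ₐ[−x_a f(x[a ↦ τx_a]) − (1 − x_a) f(x[a ↦ τ + (1 − τ)x_a])]` whose bracket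
agrees on the two `a`-faces; two elements, transcendence-free, value-free. With rungs 12–13 every rule of the smooth cubical
calculus (permutations, reflections, triangular reparametrisations, subdivisions) is derivable from the fibrewise rule (3).

References: M. Kontsevich, D. Zagier, *Periods* (2001), §1.2 rules (1), (2), (3).
-/

noncomputable section

set_option linter.dupNamespace false

namespace Summit.KontsevichZagierPeriods.KontsevichZagierPeriods.Cruxes.StokesGeneration.FibrewiseStokes

open MeasureTheory Set
open Literature.NumberTheory.Transcendental
open Literature.NumberTheory.Transcendental.KZ
open Literature.ModelTheory.ExponentialFields (IsSemialgebraic)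

/-- **Subdivision of the cube along `x_a = t₀` is absorbed (core form, lead c5).** On `[0,1]^N` let `f` be
`ℚ`-semialgebraic and continuous, independent of an idle coordinate `b`, and `C¹` along the coordinate `a ≠ b` with a
`ℚ`-semialgebraic continuous fibre derivative `fₐ`; let `t₀ ∈ (0,1)` be algebraic. Cutting the cube at `x_a = t₀` and
rescaling both boxes back to the cube (Kontsevich–Zagier's rules (1) and (2) for affine maps) produces the relator
`f(x) − t₀ f(x[a ↦ t₀x_a]) − (1 − t₀) f(x[a ↦ t₀ + (1 − t₀)x_a])`; it is fibrewise-Stokes decomposable with TWO elements on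
the same cube: the homotopy of cutting heights `τ = t₀ + (1 − t₀)x_b` (ending at the trivial cut `τ = 1`) and the Euler
identity `∂_τ r_τ = ∂ₐ[−x_a f(x[a ↦ τx_a]) − (1 − x_a) f(x[a ↦ τ + (1 − τ)x_a])]`, whose bracket takes the same value
`−f(x[a ↦ τ])` on both `a`-faces. Transcendence-free, value-free. [cite: KontsevichZagier2001, §1.2 rules (1), (2), (3)] -/
theorem fibStokesDecomposable_subdivisionCore {N : ℕ} (a b : Fin N) (hab : a ≠ b) (t₀ : ℝ) (ht₀ : IsAlgebraic ℚ t₀)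
    (ht₀I : t₀ ∈ Set.Ioo (0:ℝ) 1) (f fₐ : (Fin N → ℝ) → ℝ)
    (hf : IsSemialgebraicFunOn ℚ (Set.pi Set.univ (fun _ : Fin N => Set.Icc (0:ℝ) 1)) f)
    (hfₐ : IsSemialgebraicFunOn ℚ (Set.pi Set.univ (fun _ : Fin N => Set.Icc (0:ℝ) 1)) fₐ)
    (hfc : ContinuousOn f (Set.pi Set.univ (fun _ : Fin N => Set.Icc (0:ℝ) 1)))
    (hfₐc : ContinuousOn fₐ (Set.pi Set.univ (fun _ : Fin N => Set.Icc (0:ℝ) 1)))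
    (hfb : ∀ x s, f (Function.update x b s) = f x)
    (hfd : ∀ x ∈ Set.pi Set.univ (fun _ : Fin N => Set.Icc (0:ℝ) 1), x a ∈ Set.Ioo (0:ℝ) 1 →
      HasDerivAt (fun s => f (Function.update x a s)) (fₐ x) (x a)) :
    FibStokesDecomposable N (fun x => f x - t₀ * f (Function.update x a (t₀ * x a)) -
      (1 - t₀) * f (Function.update x a (t₀ + (1 - t₀) * x a))) := by
  classical
  set C : Set (Fin N → ℝ) := Set.pi Set.univ (fun _ : Fin N => Set.Icc (0:ℝ) 1) with hC
  have hCsa : IsSemialgebraic ℚ C := by rw [hC, ← cube_eq_pi]; exact isSemialgebraic_cube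
  have hCc : IsCompact C := isCompact_univ_pi fun _ => isCompact_Icc
  have hmem : ∀ x ∈ C, ∀ i, x i ∈ Set.Icc (0:ℝ) 1 := fun x hx i => (Set.mem_univ_pi.mp hx) i
  have hupd : ∀ x ∈ C, ∀ (i : Fin N), ∀ s ∈ Set.Icc (0:ℝ) 1, Function.update x i s ∈ C :=
    fun x hx i s hs => update_mem_cubePi hx i hs
  have hba : b ≠ a := fun h' => hab h'.symm
  have h0I : (0:ℝ) ∈ Set.Icc (0:ℝ) 1 := ⟨le_rfl, zero_le_one⟩
  have h1I : (1:ℝ) ∈ Set.Icc (0:ℝ) 1 := ⟨zero_le_one, le_rfl⟩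
  have h1t₀ : IsAlgebraic ℚ (1 - t₀) := isAlgebraic_one.sub ht₀
  -- the fibre derivative at an arbitrary interior height
  have hHf : ∀ x ∈ C, ∀ u₀ ∈ Set.Ioo (0:ℝ) 1,
      HasDerivAt (fun u => f (Function.update x a u)) (fₐ (Function.update x a u₀)) u₀ := by
    intro x hx u₀ hu₀
    have := hfd _ (hupd x hx a u₀ (Set.Ioo_subset_Icc_self hu₀)) (by simpa using hu₀)
    simpa [Function.update_idem] using this
  -- the cutting height `τ = t₀ + (1 - t₀) x_b ∈ [t₀, 1]` and the two rescaled heights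
  obtain ⟨τ, hτ⟩ : ∃ τ : (Fin N → ℝ) → ℝ, τ = fun x => t₀ + (1 - t₀) * x b := ⟨_, rfl⟩
  have hτI : ∀ x ∈ C, t₀ ≤ τ x ∧ τ x ≤ 1 := by
    intro x hx; have hxb := hmem x hx b; rw [hτ]
    exact ⟨by nlinarith [hxb.1, ht₀I.2], by nlinarith [hxb.2, ht₀I.2]⟩
  have hτpos : ∀ x ∈ C, 0 < τ x := fun x hx => ht₀I.1.trans_le (hτI x hx).1
  obtain ⟨H1, hH1⟩ : ∃ H1 : (Fin N → ℝ) → (Fin N → ℝ), H1 = fun x => Function.update x a (τ x * x a) := ⟨_, rfl⟩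
  obtain ⟨H2, hH2⟩ : ∃ H2 : (Fin N → ℝ) → (Fin N → ℝ), H2 = fun x =>
      Function.update x a (τ x + (1 - τ x) * x a) := ⟨_, rfl⟩
  have hh1I : ∀ x ∈ C, τ x * x a ∈ Set.Icc (0:ℝ) 1 := by
    intro x hx; have hxa := hmem x hx a; have h := hτI x hx
    exact ⟨mul_nonneg (hτpos x hx).le hxa.1, by nlinarith [hxa.1, hxa.2, h.1, h.2, ht₀I.1]⟩
  have hh2I : ∀ x ∈ C, τ x + (1 - τ x) * x a ∈ Set.Icc (0:ℝ) 1 := by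
    intro x hx; have hxa := hmem x hx a; have h := hτI x hx
    exact ⟨by nlinarith [hxa.1, h.1, h.2, ht₀I.1], by nlinarith [hxa.2, h.1, h.2, ht₀I.1]⟩
  have hH1C : ∀ x ∈ C, H1 x ∈ C := fun x hx => by rw [hH1]; exact hupd x hx a _ (hh1I x hx)
  have hH2C : ∀ x ∈ C, H2 x ∈ C := fun x hx => by rw [hH2]; exact hupd x hx a _ (hh2I x hx)
  -- semialgebraic atoms and maps
  have hxa : IsSemialgebraicFunOn ℚ C (fun x => x a) := isSemialgebraicFunOn_apply hCsa a
  have hxb : IsSemialgebraicFunOn ℚ C (fun x => x b) := isSemialgebraicFunOn_apply hCsa b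
  have hcst : ∀ {t : ℝ}, IsAlgebraic ℚ t → IsSemialgebraicFunOn ℚ C (fun _ => t) := fun ht =>
    isSemialgebraicFunOn_const_of_isAlgebraic hCsa ht
  have hτsa : IsSemialgebraicFunOn ℚ C τ := by rw [hτ]; exact (hcst ht₀).fun_add ((hcst h1t₀).fun_mul hxb)
  have hτc : Continuous τ := by rw [hτ]; exact continuous_const.add (continuous_const.mul (continuous_apply b))
  have hg1sa : IsSemialgebraicFunOn ℚ C (fun x => τ x * x a) := hτsa.fun_mul hxa
  have hg2sa : IsSemialgebraicFunOn ℚ C (fun x => τ x + (1 - τ x) * x a) :=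
    hτsa.fun_add (((hcst isAlgebraic_one).fun_sub hτsa).fun_mul hxa)
  have hg1c : Continuous fun x : Fin N → ℝ => τ x * x a := hτc.mul (continuous_apply a)
  have hg2c : Continuous fun x : Fin N → ℝ => τ x + (1 - τ x) * x a :=
    hτc.add ((continuous_const.sub hτc).mul (continuous_apply a))
  have hmap_sa : ∀ {g : (Fin N → ℝ) → ℝ}, IsSemialgebraicFunOn ℚ C g →
      IsSemialgebraicMapOn ℚ C (fun x => Function.update x a (g x)) := by
    intro g hg
    refine IsSemialgebraicMapOn.of_forall hCsa fun j => ?_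
    rcases eq_or_ne j a with rfl | hja
    · exact hg.congr fun x _ => by simp
    · exact (isSemialgebraicFunOn_apply hCsa j).congr fun x _ => by simp [Function.update_of_ne hja]
  have hH1sa : IsSemialgebraicMapOn ℚ C H1 := by rw [hH1]; exact hmap_sa hg1sa
  have hH2sa : IsSemialgebraicMapOn ℚ C H2 := by rw [hH2]; exact hmap_sa hg2sa
  have hH1c : Continuous H1 := by rw [hH1]; exact continuous_id.update a hg1c
  have hH2c : Continuous H2 := by rw [hH2]; exact continuous_id.update a hg2c
  have hfH1 : IsSemialgebraicFunOn ℚ C (fun x => f (H1 x)) := IsSemialgebraicFunOn.comp_isSemialgebraicMapOn_holds hf hH1sa hH1C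
  have hfH2 : IsSemialgebraicFunOn ℚ C (fun x => f (H2 x)) := IsSemialgebraicFunOn.comp_isSemialgebraicMapOn_holds hf hH2sa hH2C
  have hfₐH1 : IsSemialgebraicFunOn ℚ C (fun x => fₐ (H1 x)) :=
    IsSemialgebraicFunOn.comp_isSemialgebraicMapOn_holds hfₐ hH1sa hH1C
  have hfₐH2 : IsSemialgebraicFunOn ℚ C (fun x => fₐ (H2 x)) :=
    IsSemialgebraicFunOn.comp_isSemialgebraicMapOn_holds hfₐ hH2sa hH2C
  have hfH1c : ContinuousOn (fun x => f (H1 x)) C := hfc.comp hH1c.continuousOn hH1C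
  have hfH2c : ContinuousOn (fun x => f (H2 x)) C := hfc.comp hH2c.continuousOn hH2C
  have hfₐH1c : ContinuousOn (fun x => fₐ (H1 x)) C := hfₐc.comp hH1c.continuousOn hH1C
  have hfₐH2c : ContinuousOn (fun x => fₐ (H2 x)) C := hfₐc.comp hH2c.continuousOn hH2C
  -- the witnesses
  obtain ⟨G0, hG0⟩ : ∃ G0 : (Fin N → ℝ) → ℝ, G0 = fun x =>
      f x - τ x * f (H1 x) - (1 - τ x) * f (H2 x) := ⟨_, rfl⟩
  obtain ⟨D0, hD0⟩ : ∃ D0 : (Fin N → ℝ) → ℝ, D0 = fun x =>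
      (1 - t₀) * (-f (H1 x) - τ x * x a * fₐ (H1 x) + f (H2 x) - (1 - τ x) * (1 - x a) * fₐ (H2 x)) := ⟨_, rfl⟩
  obtain ⟨G1, hG1⟩ : ∃ G1 : (Fin N → ℝ) → ℝ, G1 = fun x =>
      (1 - t₀) * (x a * f (H1 x) + (1 - x a) * f (H2 x)) := ⟨_, rfl⟩
  obtain ⟨D1, hD1⟩ : ∃ D1 : (Fin N → ℝ) → ℝ, D1 = fun x =>
      (1 - t₀) * (f (H1 x) + x a * τ x * fₐ (H1 x) - f (H2 x) + (1 - x a) * (1 - τ x) * fₐ (H2 x)) := ⟨_, rfl⟩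
  have h1sa : IsSemialgebraicFunOn ℚ C (fun _ => (1:ℝ)) := hcst isAlgebraic_one
  have hG0sa : IsSemialgebraicFunOn ℚ C G0 := by
    rw [hG0]; exact (hf.fun_sub (hτsa.fun_mul hfH1)).fun_sub ((h1sa.fun_sub hτsa).fun_mul hfH2)
  have hD0sa : IsSemialgebraicFunOn ℚ C D0 := by
    rw [hD0]
    exact (hcst h1t₀).fun_mul (((hfH1.fun_neg.fun_sub ((hτsa.fun_mul hxa).fun_mul hfₐH1)).fun_add hfH2).fun_sub
      (((h1sa.fun_sub hτsa).fun_mul (h1sa.fun_sub hxa)).fun_mul hfₐH2))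
  have hG1sa : IsSemialgebraicFunOn ℚ C G1 := by
    rw [hG1]; exact (hcst h1t₀).fun_mul ((hxa.fun_mul hfH1).fun_add ((h1sa.fun_sub hxa).fun_mul hfH2))
  have hD1sa : IsSemialgebraicFunOn ℚ C D1 := by
    rw [hD1]
    exact (hcst h1t₀).fun_mul ((((hfH1.fun_add ((hxa.fun_mul hτsa).fun_mul hfₐH1)).fun_sub hfH2).fun_add
      (((h1sa.fun_sub hxa).fun_mul (h1sa.fun_sub hτsa)).fun_mul hfₐH2)))
  have hxac : ContinuousOn (fun x : Fin N → ℝ => x a) C := (continuous_apply a).continuousOn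
  have hG0c : ContinuousOn G0 C := by
    rw [hG0]; exact (hfc.sub (hτc.continuousOn.mul hfH1c)).sub ((continuousOn_const.sub hτc.continuousOn).mul hfH2c)
  have hD0c : ContinuousOn D0 C := by
    rw [hD0]
    exact continuousOn_const.mul ((((hfH1c.neg).sub ((hτc.continuousOn.mul hxac).mul hfₐH1c)).add hfH2c).sub
      (((continuousOn_const.sub hτc.continuousOn).mul (continuousOn_const.sub hxac)).mul hfₐH2c))
  have hG1c : ContinuousOn G1 C := by
    rw [hG1]; exact continuousOn_const.mul ((hxac.mul hfH1c).add ((continuousOn_const.sub hxac).mul hfH2c))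
  have hD1c : ContinuousOn D1 C := by
    rw [hD1]
    exact continuousOn_const.mul (((hfH1c.add ((hxac.mul hτc.continuousOn).mul hfₐH1c)).sub hfH2c).add
      (((continuousOn_const.sub hxac).mul (continuousOn_const.sub hτc.continuousOn)).mul hfₐH2c))
  -- face maps
  have hface_sa : ∀ {F : (Fin N → ℝ) → ℝ}, IsSemialgebraicFunOn ℚ C F → ∀ (i : Fin N) (t : ℝ), IsAlgebraic ℚ t →
      t ∈ Set.Icc (0:ℝ) 1 → IsSemialgebraicFunOn ℚ C (fun x => F (Function.update x i t)) :=
    fun hF i t ht htI => IsSemialgebraicFunOn.comp_isSemialgebraicMapOn_holds hF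
      (isSemialgebraicMapOn_update_const i ht) fun x hx => hupd x hx i t htI
  have hface_c : ∀ {F : (Fin N → ℝ) → ℝ}, ContinuousOn F C → ∀ (i : Fin N) (t : ℝ), t ∈ Set.Icc (0:ℝ) 1 →
      ContinuousOn (fun x => F (Function.update x i t)) C :=
    fun hF i t htI => hF.comp (continuous_id.update i continuous_const).continuousOn fun x hx => hupd x hx i t htI
  have hcu : ∀ (x : Fin N → ℝ) (i : Fin N), Continuous fun s : ℝ => Function.update x i s :=
    fun x i => continuous_const.update i continuous_id
  -- integrands and representations
  obtain ⟨I0, hI0⟩ : ∃ I0 : (Fin N → ℝ) → ℝ, I0 = fun x =>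
      D0 x - (G0 (Function.update x b 1) - G0 (Function.update x b 0)) := ⟨_, rfl⟩
  obtain ⟨I1, hI1⟩ : ∃ I1 : (Fin N → ℝ) → ℝ, I1 = fun x =>
      D1 x - (G1 (Function.update x a 1) - G1 (Function.update x a 0)) := ⟨_, rfl⟩
  have hI0sa : IsSemialgebraicFunOn ℚ C I0 := by
    rw [hI0]
    exact hD0sa.fun_sub ((hface_sa hG0sa b 1 isAlgebraic_one h1I).fun_sub (hface_sa hG0sa b 0 isAlgebraic_zero h0I))
  have hI1sa : IsSemialgebraicFunOn ℚ C I1 := by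
    rw [hI1]
    exact hD1sa.fun_sub ((hface_sa hG1sa a 1 isAlgebraic_one h1I).fun_sub (hface_sa hG1sa a 0 isAlgebraic_zero h0I))
  have hI0c : ContinuousOn I0 C := by
    rw [hI0]; exact hD0c.sub ((hface_c hG0c b 1 h1I).sub (hface_c hG0c b 0 h0I))
  have hI1c : ContinuousOn I1 C := by
    rw [hI1]; exact hD1c.sub ((hface_c hG1c a 1 h1I).sub (hface_c hG1c a 0 h0I))
  obtain ⟨q0, hq0d, hq0i⟩ := exists_cubeRep N I0 hI0sa hI0c
  obtain ⟨q1, hq1d, hq1i⟩ := exists_cubeRep N I1 hI1sa hI1c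
  have hbound : ∀ {F : (Fin N → ℝ) → ℝ}, ContinuousOn F C → ∃ B : ℝ, ∀ x ∈ C, |F x| ≤ B := fun hF => by
    obtain ⟨B, hB⟩ := hCc.exists_bound_of_continuousOn hF
    exact ⟨B, fun x hx => by simpa [Real.norm_eq_abs] using hB x hx⟩
  -- bookkeeping along the fibres
  have hτ_b : ∀ x s, τ (Function.update x b s) = t₀ + (1 - t₀) * s := by intro x s; rw [hτ]; simp
  have hτ_a : ∀ x s, τ (Function.update x a s) = τ x := by intro x s; rw [hτ]; simp [Function.update_of_ne hba]
  have hfH1_b : ∀ x s, f (H1 (Function.update x b s)) = f (Function.update x a ((t₀ + (1 - t₀) * s) * x a)) := by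
    intro x s; rw [hH1]; simp only [hτ_b, Function.update_of_ne hab]; rw [Function.update_comm hba, hfb]
  have hfH2_b : ∀ x s, f (H2 (Function.update x b s)) =
      f (Function.update x a ((t₀ + (1 - t₀) * s) + (1 - (t₀ + (1 - t₀) * s)) * x a)) := by
    intro x s; rw [hH2]; simp only [hτ_b, Function.update_of_ne hab]; rw [Function.update_comm hba, hfb]
  have hH1_a : ∀ x s, H1 (Function.update x a s) = Function.update x a (τ x * s) := by
    intro x s; rw [hH1]; simp only [hτ_a, Function.update_self, Function.update_idem]
  have hH2_a : ∀ x s, H2 (Function.update x a s) = Function.update x a (τ x + (1 - τ x) * s) := by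
    intro x s; rw [hH2]; simp only [hτ_a, Function.update_self, Function.update_idem]
  -- assemble
  have hdec : FibStokesDecomposable N (fun x => ∑ j, ((![q0, q1] : Fin 2 → IntegralRep N) j).integrand x) := by
    refine fibStokesDecomposable_of_elements (M := N) (J := 2) (![b, a] : Fin 2 → Fin N)
      (![G0, G1] : Fin 2 → (Fin N → ℝ) → ℝ) (![D0, D1] : Fin 2 → (Fin N → ℝ) → ℝ)
      (![q0, q1] : Fin 2 → IntegralRep N) ?_ ?_
    · refine Fin.forall_fin_two.mpr ⟨?_, ?_⟩
      · -- element 0, along `b` (the cutting height)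
        simp only [Matrix.cons_val_zero]
        refine ⟨hG0sa, hD0sa, hbound hG0c, fun x hx => ?_, fun x hx hxb' => ?_⟩
        · exact hG0c.comp (hcu x b).continuousOn fun s hs => hupd x hx b s hs
        · have hxbI : x b ∈ Set.Ioo (0:ℝ) 1 := by simpa using hxb'
          have hfun : (fun s : ℝ => G0 (Function.update x b s)) = fun s =>
              f x - (t₀ + (1 - t₀) * s) * f (Function.update x a ((t₀ + (1 - t₀) * s) * x a)) -
                (1 - (t₀ + (1 - t₀) * s)) *
                  f (Function.update x a ((t₀ + (1 - t₀) * s) + (1 - (t₀ + (1 - t₀) * s)) * x a)) := by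
            funext s; rw [hG0]; simp only [hfb, hτ_b, hfH1_b, hfH2_b]
          rw [hfun, hD0]
          simp only
          have hH1x : H1 x = Function.update x a (τ x * x a) := by rw [hH1]
          have hH2x : H2 x = Function.update x a (τ x + (1 - τ x) * x a) := by rw [hH2]
          have hτx : τ x = t₀ + (1 - t₀) * x b := by rw [hτ]
          have hτxI : τ x ∈ Set.Ioo (0:ℝ) 1 := by
            rw [hτx]; exact ⟨by nlinarith [hxbI.1, ht₀I.1, ht₀I.2], by nlinarith [hxbI.2, ht₀I.1, ht₀I.2]⟩
          -- the affine height map `s ↦ t₀ + (1 - t₀) s`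
          have hT : HasDerivAt (fun s : ℝ => t₀ + (1 - t₀) * s) (1 - t₀) (x b) := by
            simpa using ((hasDerivAt_id' (x b)).const_mul (1 - t₀)).const_add t₀
          -- first term `T(s) · f(x[a ↦ T(s) x_a])`
          have hterm1 : HasDerivAt (fun s : ℝ => (t₀ + (1 - t₀) * s) * f (Function.update x a ((t₀ + (1 - t₀) * s) * x a)))
              ((1 - t₀) * f (Function.update x a (τ x * x a)) +
                τ x * (fₐ (Function.update x a (τ x * x a)) * ((1 - t₀) * x a))) (x b) := by
            rcases (hmem x hx a).1.eq_or_lt with ha0 | hapos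
            · rw [← ha0]
              simp only [mul_zero]
              have := hT.mul_const (f (Function.update x a 0))
              exact this.congr_deriv (by ring)
            · have hin : HasDerivAt (fun s : ℝ => (t₀ + (1 - t₀) * s) * x a) ((1 - t₀) * x a) (x b) := hT.mul_const _
              have hI : τ x * x a ∈ Set.Ioo (0:ℝ) 1 :=
                ⟨mul_pos hτxI.1 hapos, by nlinarith [hτxI.2, (hmem x hx a).2, hτxI.1]⟩
              have hout := hHf x hx _ hI
              have hin0 : (fun s : ℝ => (t₀ + (1 - t₀) * s) * x a) (x b) = τ x * x a := by rw [hτx]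
              rw [← hin0] at hout
              have hcomp := HasDerivAt.comp (x b) (h₂ := fun v => f (Function.update x a v)) hout hin
              have := hT.mul hcomp
              rw [hτx]
              refine this.congr_deriv ?_
              simp only [Function.comp]
          -- second term `(1 - T(s)) · f(x[a ↦ T(s) + (1 - T(s)) x_a])`
          have hterm2 : HasDerivAt (fun s : ℝ => (1 - (t₀ + (1 - t₀) * s)) *
              f (Function.update x a ((t₀ + (1 - t₀) * s) + (1 - (t₀ + (1 - t₀) * s)) * x a)))
              (-(1 - t₀) * f (Function.update x a (τ x + (1 - τ x) * x a)) +
                (1 - τ x) * (fₐ (Function.update x a (τ x + (1 - τ x) * x a)) * ((1 - t₀) * (1 - x a)))) (x b) := by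
            have hT' : HasDerivAt (fun s : ℝ => 1 - (t₀ + (1 - t₀) * s)) (-(1 - t₀)) (x b) := by
              simpa using hT.const_sub 1
            rcases (hmem x hx a).2.eq_or_lt with ha1 | halt1
            · rw [ha1]
              have hfun' : (fun s : ℝ => (1 - (t₀ + (1 - t₀) * s)) *
                  f (Function.update x a ((t₀ + (1 - t₀) * s) + (1 - (t₀ + (1 - t₀) * s)) * 1))) =
                  fun s => (1 - (t₀ + (1 - t₀) * s)) * f (Function.update x a 1) := by
                funext s; ring_nf
              rw [hfun']
              have := hT'.mul_const (f (Function.update x a 1))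
              refine this.congr_deriv ?_
              rw [hτx]; ring_nf
            · have hin : HasDerivAt (fun s : ℝ => (t₀ + (1 - t₀) * s) + (1 - (t₀ + (1 - t₀) * s)) * x a)
                  ((1 - t₀) * (1 - x a)) (x b) := by
                have := hT.add (hT'.mul_const (x a))
                exact this.congr_deriv (by ring)
              have hI : τ x + (1 - τ x) * x a ∈ Set.Ioo (0:ℝ) 1 :=
                ⟨by nlinarith [hτxI.1, hτxI.2, (hmem x hx a).1], by nlinarith [hτxI.2, halt1, hτxI.1]⟩
              have hout := hHf x hx _ hI
              have hin0 : (fun s : ℝ => (t₀ + (1 - t₀) * s) + (1 - (t₀ + (1 - t₀) * s)) * x a) (x b) =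
                  τ x + (1 - τ x) * x a := by rw [hτx]
              rw [← hin0] at hout
              have hcomp := HasDerivAt.comp (x b) (h₂ := fun v => f (Function.update x a v)) hout hin
              have := hT'.mul hcomp
              rw [hτx]
              refine this.congr_deriv ?_
              simp only [Function.comp]
          have hall := ((hasDerivAt_const (x b) (f x)).sub hterm1).sub hterm2
          rw [hH1x, hH2x]
          refine hall.congr_deriv ?_
          ring
      · -- element 1, along `a`
        simp only [Matrix.cons_val_one, Matrix.cons_val_zero]
        refine ⟨hG1sa, hD1sa, hbound hG1c, fun x hx => ?_, fun x hx hxa' => ?_⟩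
        · exact hG1c.comp (hcu x a).continuousOn fun s hs => hupd x hx a s hs
        · have hxaI : x a ∈ Set.Ioo (0:ℝ) 1 := by simpa using hxa'
          have hfun : (fun s : ℝ => G1 (Function.update x a s)) = fun s =>
              (1 - t₀) * (s * f (Function.update x a (τ x * s)) + (1 - s) * f (Function.update x a (τ x + (1 - τ x) * s))) := by
            funext s; rw [hG1]; simp only [hH1_a, hH2_a, Function.update_self]
          rw [hfun, hD1]
          simp only
          have hH1x : H1 x = Function.update x a (τ x * x a) := by rw [hH1]
          have hH2x : H2 x = Function.update x a (τ x + (1 - τ x) * x a) := by rw [hH2]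
          have hτx1 : t₀ ≤ τ x ∧ τ x ≤ 1 := hτI x hx
          have hτp : 0 < τ x := hτpos x hx
          -- first term `s · f(x[a ↦ τ s])`
          have hterm1 : HasDerivAt (fun s : ℝ => s * f (Function.update x a (τ x * s)))
              (f (Function.update x a (τ x * x a)) + x a * (fₐ (Function.update x a (τ x * x a)) * τ x)) (x a) := by
            have hin : HasDerivAt (fun s : ℝ => τ x * s) (τ x) (x a) := by
              simpa using (hasDerivAt_id' (x a)).const_mul (τ x)
            have hI : τ x * x a ∈ Set.Ioo (0:ℝ) 1 :=
              ⟨mul_pos hτp hxaI.1, by nlinarith [hτx1.2, hxaI.2, hτp]⟩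
            have hout := hHf x hx _ hI
            have hin0 : (fun s : ℝ => τ x * s) (x a) = τ x * x a := rfl
            rw [← hin0] at hout
            have hcomp := HasDerivAt.comp (x a) (h₂ := fun v => f (Function.update x a v)) hout hin
            exact ((hasDerivAt_id' (x a)).mul hcomp).congr_deriv (by simp)
          -- second term `(1 - s) · f(x[a ↦ τ + (1 - τ) s])`
          have hterm2 : HasDerivAt (fun s : ℝ => (1 - s) * f (Function.update x a (τ x + (1 - τ x) * s)))
              (-f (Function.update x a (τ x + (1 - τ x) * x a)) +
                (1 - x a) * (fₐ (Function.update x a (τ x + (1 - τ x) * x a)) * (1 - τ x))) (x a) := by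
            have hl : HasDerivAt (fun s : ℝ => 1 - s) (-1) (x a) := (hasDerivAt_id' (x a)).const_sub 1
            rcases hτx1.2.eq_or_lt with hτ1 | hτlt1
            · rw [hτ1]
              have hfun' : (fun s : ℝ => (1 - s) * f (Function.update x a (1 + (1 - 1) * s))) =
                  fun s => (1 - s) * f (Function.update x a 1) := by
                funext s; ring_nf
              rw [hfun']
              refine (hl.mul_const (f (Function.update x a 1))).congr_deriv ?_
              ring_nf
            · have hin : HasDerivAt (fun s : ℝ => τ x + (1 - τ x) * s) (1 - τ x) (x a) := by
                simpa using ((hasDerivAt_id' (x a)).const_mul (1 - τ x)).const_add (τ x)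
              have hI : τ x + (1 - τ x) * x a ∈ Set.Ioo (0:ℝ) 1 :=
                ⟨by nlinarith [hτp, hτlt1, hxaI.1], by nlinarith [hτlt1, hxaI.2, hτp]⟩
              have hout := hHf x hx _ hI
              have hin0 : (fun s : ℝ => τ x + (1 - τ x) * s) (x a) = τ x + (1 - τ x) * x a := rfl
              rw [← hin0] at hout
              have hcomp := HasDerivAt.comp (x a) (h₂ := fun v => f (Function.update x a v)) hout hin
              exact (hl.mul hcomp).congr_deriv (by simp)
          have hall := (hterm1.add hterm2).const_mul (1 - t₀)
          rw [hH1x, hH2x]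
          refine hall.congr_deriv ?_
          ring
    · refine Fin.forall_fin_two.mpr ⟨?_, ?_⟩
      · simp only [Matrix.cons_val_zero]
        exact ⟨hq0d, fun x _ => by rw [hq0i, hI0]⟩
      · simp only [Matrix.cons_val_one, Matrix.cons_val_zero]
        exact ⟨hq1d, fun x _ => by rw [hq1i, hI1]⟩
  -- the pointwise identity
  refine fibStokesDecomposable_congr_off_null N _ _ ∅
    Literature.ModelTheory.ExponentialFields.isSemialgebraic_empty measure_empty (fun x hx _ => ?_) hdec
  have hface0 : G0 (Function.update x b 1) - G0 (Function.update x b 0) =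
      -(f x - t₀ * f (Function.update x a (t₀ * x a)) - (1 - t₀) * f (Function.update x a (t₀ + (1 - t₀) * x a))) := by
    rw [hG0]; simp only [hfb, hτ_b, hfH1_b, hfH2_b]; norm_num
  have hface1 : G1 (Function.update x a 1) - G1 (Function.update x a 0) = 0 := by
    rw [hG1]; simp only [hH1_a, hH2_a, Function.update_self]; ring_nf
  have hsum : D0 x + D1 x = 0 := by rw [hD0, hD1]; simp only; ring
  simp only [Fin.sum_univ_two, Matrix.cons_val_zero, Matrix.cons_val_one, hq0i, hq1i, hI0, hI1, hface0, hface1]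
  linarith

/-- **Subdivision of the cube along a coordinate hyperplane is absorbed, in any dimension (lead c5).** For `f`
`ℚ`-semialgebraic and continuous on `[0,1]^N`, `C¹` along the coordinate `a` with a `ℚ`-semialgebraic continuous fibre
derivative `fₐ` (open fibres), and an algebraic cutting height `t₀ ∈ (0,1)`, the subdivision relator
`f(x) − t₀ f(x[a ↦ t₀x_a]) − (1 − t₀) f(x[a ↦ t₀ + (1 − t₀)x_a])` (rules (1)+(2): cut at `x_a = t₀`, rescale both boxes to the
cube) is fibrewise-Stokes decomposable on `[0,1]^N` — `fibStokesDecomposable_subdivisionCore` on `[0,1]^{N+1}`, un-padded.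
Transcendence-free, value-free. [cite: KontsevichZagier2001, §1.2 rules (1), (2), (3)] -/
theorem fibStokesDecomposable_sub_subdivision {N : ℕ} (a : Fin N) (t₀ : ℝ) (ht₀ : IsAlgebraic ℚ t₀)
    (ht₀I : t₀ ∈ Set.Ioo (0:ℝ) 1) (f fₐ : (Fin N → ℝ) → ℝ)
    (hf : IsSemialgebraicFunOn ℚ (Set.pi Set.univ (fun _ : Fin N => Set.Icc (0:ℝ) 1)) f)
    (hfₐ : IsSemialgebraicFunOn ℚ (Set.pi Set.univ (fun _ : Fin N => Set.Icc (0:ℝ) 1)) fₐ)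
    (hfc : ContinuousOn f (Set.pi Set.univ (fun _ : Fin N => Set.Icc (0:ℝ) 1)))
    (hfₐc : ContinuousOn fₐ (Set.pi Set.univ (fun _ : Fin N => Set.Icc (0:ℝ) 1)))
    (hfd : ∀ x ∈ Set.pi Set.univ (fun _ : Fin N => Set.Icc (0:ℝ) 1), x a ∈ Set.Ioo (0:ℝ) 1 →
      HasDerivAt (fun s => f (Function.update x a s)) (fₐ x) (x a)) :
    FibStokesDecomposable N (fun x => f x - t₀ * f (Function.update x a (t₀ * x a)) -
      (1 - t₀) * f (Function.update x a (t₀ + (1 - t₀) * x a))) := by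
  have hCM : IsSemialgebraic ℚ (Set.pi Set.univ (fun _ : Fin (N + 1) => Set.Icc (0:ℝ) 1)) := by
    rw [← cube_eq_pi]; exact isSemialgebraic_cube
  have hne : ∀ j : Fin N, Fin.castSucc j ≠ Fin.last N := fun j => (Fin.castSucc_lt_last j).ne
  have hread : ∀ {F : (Fin N → ℝ) → ℝ}, IsSemialgebraicFunOn ℚ (Set.pi Set.univ (fun _ : Fin N => Set.Icc (0:ℝ) 1)) F →
      IsSemialgebraicFunOn ℚ (Set.pi Set.univ (fun _ : Fin (N + 1) => Set.Icc (0:ℝ) 1))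
        (fun y => F (fun j => y (Fin.castSucc j))) :=
    fun hF => (isSemialgebraicFunOn_comp_coord hF Fin.castSucc).mono (fun y hy => comp_reading_mem_cubePi _ hy) hCM
  have hπc : Continuous fun y : Fin (N + 1) → ℝ => fun j => y (Fin.castSucc j) :=
    continuous_pi fun j => continuous_apply (Fin.castSucc j)
  have hreadc : ∀ {F : (Fin N → ℝ) → ℝ}, ContinuousOn F (Set.pi Set.univ (fun _ : Fin N => Set.Icc (0:ℝ) 1)) →
      ContinuousOn (fun y => F (fun j => y (Fin.castSucc j))) (Set.pi Set.univ (fun _ : Fin (N + 1) => Set.Icc (0:ℝ) 1)) :=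
    fun hF => hF.comp hπc.continuousOn fun y hy => comp_reading_mem_cubePi _ hy
  have hcu : ∀ (y : Fin (N + 1) → ℝ) (t : ℝ),
      (fun j => Function.update y (Fin.castSucc a) t (Fin.castSucc j)) =
        Function.update (fun j => y (Fin.castSucc j)) a t :=
    fun y t => comp_update_of_injective (Fin.castSucc_injective N) y a t
  have key := fibStokesDecomposable_subdivisionCore (Fin.castSucc a) (Fin.last N) (hne a) t₀ ht₀ ht₀I
    (fun y => f (fun j => y (Fin.castSucc j))) (fun y => fₐ (fun j => y (Fin.castSucc j)))
    (hread hf) (hread hfₐ) (hreadc hfc) (hreadc hfₐc)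
    (fun y s => by simp only [Function.update_of_ne (hne _)])
    (fun y hy hya => by
      have := hfd _ (comp_reading_mem_cubePi _ hy) (by simpa using hya)
      simpa only [hcu] using this)
  have hle : N ≤ N + 1 := N.le_succ
  refine fibStokesDecomposable_unpad hle _ (fibStokesDecomposable_congr_off_null (N + 1) _ _ ∅
    Literature.ModelTheory.ExponentialFields.isSemialgebraic_empty measure_empty (fun y _ _ => ?_) key)
  have e1 : (fun j => y (Fin.castSucc j)) = fun l => y (Fin.castLE hle l) := rfl
  have e2 : y (Fin.castSucc a) = y (Fin.castLE hle a) := rfl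
  simp only [hcu, e1, e2]

end Summit.KontsevichZagierPeriods.KontsevichZagierPeriods.Cruxes.StokesGeneration.FibrewiseStokes

end
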